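import Summits.KontsevichZagierPeriods.KontsevichZagierPeriods.Theorems.UnfoldedStokesStokesGenerationFibrewiseRungAngularSectorAux
import Summits.KontsevichZagierPeriods.KontsevichZagierPeriods.Theorems.UnfoldedStokesStokesGenerationStubRungClampedAngularCertificate
import Summits.KontsevichZagierPeriods.KontsevichZagierPeriods.Theorems.UnfoldedStokesStokesGenerationStubRungArctanFTC
import Summits.KontsevichZagierPeriods.KontsevichZagierPeriods.Theorems.UnfoldedStokesStokesGenerationStubRungAngularCertificateSwap
import Summits.KontsevichZagierPeriods.KontsevichZagierPeriods.Theorems.UnfoldedStokesStokesGenerationStubRungConeEstimate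
import Summits.KontsevichZagierPeriods.KontsevichZagierPeriods.Theorems.UnfoldedStokesStokesGenerationStubRungPartition
import Summits.KontsevichZagierPeriods.KontsevichZagierPeriods.Theorems.UnfoldedStokesStokesGenerationStubRungLeftoverLoop
import Summits.KontsevichZagierPeriods.KontsevichZagierPeriods.Theorems.UnfoldedStokesStokesGenerationStubRungDlogProd
import Summits.KontsevichZagierPeriods.KontsevichZagierPeriods.Theorems.UnfoldedStokesStokesGenerationStubRungValue
import Summits.KontsevichZagierPeriods.KontsevichZagierPeriods.Theorems.UnfoldedStokesStokesGenerationFibrewiseRungRelations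
import Mathlib.Topology.Algebra.Polynomial

/-!
# `StokesGeneration` (stmt-KontsevichZagierPeriods-3586), line `fibrewise_stokes` — the residual S2 on the full angular sector (rung 4)

Crux `Summit.KontsevichZagierPeriods.KontsevichZagierPeriods.Theses.UnfoldedStokes.StokesGeneration` (kernel-checked
equivalent to the summit). Line `fibrewise_stokes` reduces it to the residual S2 = `FibrewiseStokesGenerationConjecture`:
every bounded closed-cube representation of value `0` is, after padding and off a null `ℚ`-semialgebraic set, a finite
sum of FIBREWISE STOKES ELEMENTS `D − (G|_{xᵢ=1} − G|_{xᵢ=0})`.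

This file completes the ARGUMENT half of the dimension-1 rational layer: the GENERAL closed angular loop. For a complex
polynomial `P = A + iB` with real algebraic coefficients and NO ZEROS on `[0,1]` (the continuous argument may leave the
right half-plane — the case lead c2 recorded as needing continuous `k`-th roots) and `γ` real algebraic, a
closed-interval representation with integrand `γ·Im(P′/P) = γ (A B′ − A′ B)/(A² + B²)` and value `0` satisfies the
conclusion of S2 with `M′ = 2`, `J = 2N + 2`, `Z` = the grid lines `{x₀ = k/N}` — ROOT-FREE:
* a rational partition `zₖ = k/N`, fine enough that the re-centred real part `A·A(zₖ) + B·B(zₖ)` stays positive on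
  piece `k` and that `M/N`, `M·tan²(M/N)` are small, `M = max |Im(P′/P)|` (`stub_rungPartition`, p127628);
* on each piece the CLAMPED half-angle certificate of rung 3 (`stub_rungClampedAngularCertificate`: two elements,
  kinks at the two grid points, boundary leftover `γ τₖ/(1 + τₖ² x₁²)`, `τₖ = Wₖ(z_{k+1})/Uₖ(z_{k+1})`);
* `arctan τₖ = ∫_{piece k} Im(P′/P)` (`stub_rungArctanFTC`, p127577), so `Σₖ arctan τₖ = value/γ = 0` and
  `|arctan τₖ| ≤ M/N`;
* the total leftover is `γ·Im(Q′/Q)` for the polynomial loop `Q(y) = Πₖ (1 + iτₖ y)` (`stub_rungLeftoverLoop`,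
  p127637: real/imaginary parts with algebraic coefficients, polar form, logarithmic derivative), which STAYS IN THE
  RIGHT HALF-PLANE since `|Σₖ arctan(τₖ y)| ≤ Σₖ |φₖ| tan² φₖ ≤ M tan²(M/N) < π/2` (`stub_rungConeEstimate`, p127621)
  and closes up at `y = 1`; rung 3 in swapped coordinates (`stub_rungAngularCertificateSwap`, p127613) absorbs it.
No roots, no change of variables, no domain additivity. With rungs 1–3 (p125207, p126066, p126092) and the mixed Baker
reduction (p126025) this puts the whole dimension-1 rational layer of S2 within reach of a partial-fractions assembly.

References: M. Kontsevich, D. Zagier, *Periods* (2001), §1.1–1.2; J. Ayoub, Ann. of Math. 181 (2015), Conj. 1.1,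
Rem. 1.5; J. Fresán, *Une introduction aux périodes* (2024), Rem. 3.7; A. Baker, *Transcendental Number Theory*
(1975), Thm. 2.1 (for the reduction, not used here).
-/

noncomputable section

set_option linter.dupNamespace false

namespace Summit.KontsevichZagierPeriods.KontsevichZagierPeriods.Cruxes.StokesGeneration.FibrewiseStokes

open MeasureTheory Set
open Literature.NumberTheory.Transcendental
open Literature.NumberTheory.Transcendental.KZ
open Literature.ModelTheory.ExponentialFields (IsSemialgebraic)

/-! ## Rung 4: the assembly -/

/-- **S2 on the full angular sector (rung 4, assembled; lead c4).** For a complex polynomial loop `P = A + iB`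
with real algebraic coefficients and no zeros on `[0,1]`, and `γ` real algebraic, a closed-interval
representation with integrand the angular derivative `γ·Im(P′/P) = γ (A B′ − A′ B)/(A² + B²)` and value `0`
(the continuous argument of `P` may leave the right half-plane in between) satisfies the conclusion of
`FibrewiseStokesGeneration` with `M′ = 2`: `2N + 2` fibrewise Stokes elements on `[0,1]²` off the null grid
`{x₀ = k/N}` — `N` clamped half-angle certificates (`stub_rungClampedAngularCertificate`, fineness
`stub_rungPartition`), whose boundary leftover is the angular derivative of the polynomial loop
`Q(y) = Πₖ (1 + iτₖ y)` (`stub_rungLeftoverLoop`; `Σ arctan τₖ = ∫₀¹ Im(P′/P) = 0` by `stub_rungArctanFTC`),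
which stays in the right half-plane (`stub_rungConeEstimate`) and is absorbed by rung 3 in swapped coordinates
(`stub_rungAngularCertificateSwap`). Root-free; no change of variables, no domain additivity.
[cite: KontsevichZagier2001, §1.2] -/
theorem fibrewiseStokesGeneration_angularSector :
    ∀ (γ : ℝ) (A B : Polynomial ℝ), IsAlgebraic ℚ γ → (∀ n, IsAlgebraic ℚ (A.coeff n)) →
      (∀ n, IsAlgebraic ℚ (B.coeff n)) → (∀ u ∈ Set.Icc (0:ℝ) 1, A.eval u ^ 2 + B.eval u ^ 2 ≠ 0) →
      ∀ (t : IntegralRep 1), t.domain = Set.pi Set.univ (fun _ : Fin 1 => Set.Icc (0:ℝ) 1) →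
      (∀ z ∈ Set.pi Set.univ (fun _ : Fin 1 => Set.Icc (0:ℝ) 1), t.integrand z =
        γ * ((A.eval (z 0) * (Polynomial.derivative B).eval (z 0) -
          (Polynomial.derivative A).eval (z 0) * B.eval (z 0)) / (A.eval (z 0) ^ 2 + B.eval (z 0) ^ 2))) →
      t.value = 0 →
    ∃ (M' : ℕ) (hMM' : 1 ≤ M') (J : ℕ) (i : Fin J → Fin M') (G D : Fin J → (Fin M' → ℝ) → ℝ)
      (K : Fin J → Set (Fin M' → ℝ)) (q : Fin J → IntegralRep M') (Z : Set (Fin M' → ℝ)),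
      (∀ j, IsSemialgebraicFunOn ℚ (Set.pi Set.univ (fun _ : Fin M' => Set.Icc (0:ℝ) 1)) (G j) ∧
        IsSemialgebraicFunOn ℚ (Set.pi Set.univ (fun _ : Fin M' => Set.Icc (0:ℝ) 1)) (D j) ∧
        IsSemialgebraic ℚ (K j) ∧
        (∃ B : ℝ, ∀ x ∈ Set.pi Set.univ (fun _ : Fin M' => Set.Icc (0:ℝ) 1), |(G j) x| ≤ B) ∧
        (∀ x ∈ Set.pi Set.univ (fun _ : Fin M' => Set.Icc (0:ℝ) 1), Set.Finite {s : ℝ | Function.update x (i j) s ∈ (K j)}) ∧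
        (∀ x ∈ Set.pi Set.univ (fun _ : Fin M' => Set.Icc (0:ℝ) 1), ContinuousOn (fun s : ℝ => (G j) (Function.update x (i j) s)) (Set.Icc (0:ℝ) 1)) ∧
        (∀ x ∈ Set.pi Set.univ (fun _ : Fin M' => Set.Icc (0:ℝ) 1), x ∉ (K j) → x (i j) ∈ Set.Ioo (0:ℝ) 1 →
          HasDerivAt (fun s : ℝ => (G j) (Function.update x (i j) s)) ((D j) x) (x (i j)))) ∧
      (∀ j, (q j).domain = Set.pi Set.univ (fun _ : Fin M' => Set.Icc (0:ℝ) 1) ∧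
        ∀ x ∈ Set.pi Set.univ (fun _ : Fin M' => Set.Icc (0:ℝ) 1), (q j).integrand x =
          D j x - (G j (Function.update x (i j) 1) - G j (Function.update x (i j) 0))) ∧
      IsSemialgebraic ℚ Z ∧ volume Z = 0 ∧
      ∀ x ∈ Set.pi Set.univ (fun _ : Fin M' => Set.Icc (0:ℝ) 1), x ∉ Z →
        t.integrand (fun l => x (Fin.castLE hMM' l)) = ∑ j, (q j).integrand x := by
  intro γ A B hγ hA hB hAB t ht hti hval
  classical
  -- the square
  set S : Set (Fin 2 → ℝ) := Set.pi Set.univ (fun _ : Fin 2 => Set.Icc (0:ℝ) 1) with hS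
  have hSsa : IsSemialgebraic ℚ S := by rw [hS, ← cube_eq_pi]; exact isSemialgebraic_cube
  have h12 : (1 : ℕ) ≤ 2 := by norm_num
  have hx1 : ∀ x ∈ S, (fun l : Fin 1 => x (Fin.castLE h12 l)) ∈
      Set.pi Set.univ (fun _ : Fin 1 => Set.Icc (0:ℝ) 1) := fun x hx l _ => hx _ (Set.mem_univ _)
  -- the angular derivative
  set h : ℝ → ℝ := fun u => (A.eval u * (Polynomial.derivative B).eval u -
    (Polynomial.derivative A).eval u * B.eval u) / (A.eval u ^ 2 + B.eval u ^ 2) with hh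
  have hti' : ∀ z ∈ Set.pi Set.univ (fun _ : Fin 1 => Set.Icc (0:ℝ) 1), t.integrand z = γ * h (z 0) :=
    fun z hz => by rw [hti z hz]
  -- trivial case `γ = 0`: no elements at all
  rcases eq_or_ne γ 0 with rfl | hγ0
  · refine ⟨2, h12, 0, Fin.elim0, Fin.elim0, Fin.elim0, Fin.elim0, Fin.elim0, ∅, fun j => j.elim0,
      fun j => j.elim0, Literature.ModelTheory.ExponentialFields.isSemialgebraic_empty, measure_empty, ?_⟩
    intro x hx _
    rw [hti' _ (hx1 x hx)]
    simp
  -- Step 1: the value hypothesis says `∫₀¹ h = 0`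
  have hcont_h : ContinuousOn h (Set.Icc (0:ℝ) 1) :=
    ((A.continuousOn.mul (Polynomial.derivative B).continuousOn).sub
      ((Polynomial.derivative A).continuousOn.mul B.continuousOn)).div
      ((A.continuousOn.pow 2).add (B.continuousOn.pow 2)) hAB
  have hint : ∫ u in (0:ℝ)..1, h u = 0 := by
    have hmeas : MeasurableSet (Set.pi Set.univ (fun _ : Fin 1 => Set.Icc (0:ℝ) 1)) :=
      MeasurableSet.univ_pi fun _ => measurableSet_Icc
    have hv := hval
    rw [IntegralRep.value, ht, setIntegral_congr_fun hmeas hti',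
      setIntegral_cubePi_one_eq (fun y => γ * h y), integral_Icc_eq_integral_Ioc,
      ← intervalIntegral.integral_of_le zero_le_one, intervalIntegral.integral_const_mul] at hv
    exact (mul_eq_zero.mp hv).resolve_left hγ0
  -- Step 2: a bound for `h` and the partition
  obtain ⟨M₀, hM₀⟩ := isCompact_Icc.exists_bound_of_continuousOn hcont_h
  set M : ℝ := max M₀ 0 with hM
  have hM0 : 0 ≤ M := le_max_right _ _
  have hMb : ∀ u ∈ Set.Icc (0:ℝ) 1, |h u| ≤ M := fun u hu =>
    ((Real.norm_eq_abs _).symm.le.trans (hM₀ u hu)).trans (le_max_left _ _)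
  obtain ⟨N, hN1, hpos, hMN, htan⟩ := stub_rungPartition A B M hAB hM0
  have hNpos : (0:ℝ) < N := by exact_mod_cast hN1
  have hNne : (N:ℝ) ≠ 0 := hNpos.ne'
  -- Step 3: the grid and the re-centred loops
  set z : ℕ → ℝ := fun k => (k : ℝ) / N with hz
  have hz_succ : ∀ k : ℕ, z (k + 1) = ((k : ℝ) + 1) / N := fun k => by simp [hz]
  have hz0 : z 0 = 0 := by simp [hz]
  have hzN : z N = 1 := by simp [hz, div_self hNne]
  have hz_le : ∀ k : ℕ, z k ≤ z (k + 1) := fun k => by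
    rw [hz_succ]; exact div_le_div_of_nonneg_right (by linarith) hNpos.le
  have hz_lt : ∀ k : ℕ, z k < z (k + 1) := fun k => by
    rw [hz_succ]; exact div_lt_div_of_pos_right (by linarith) hNpos
  have hz_nonneg : ∀ k : ℕ, 0 ≤ z k := fun k => by positivity
  have hz_le_one : ∀ k : ℕ, k ≤ N → z k ≤ 1 := fun k hk => by
    rw [div_le_one hNpos]; exact_mod_cast hk
  have hz_mem : ∀ k : ℕ, k ≤ N → z k ∈ Set.Icc (0:ℝ) 1 := fun k hk => ⟨hz_nonneg k, hz_le_one k hk⟩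
  have hz_sub : ∀ k : ℕ, z (k + 1) - z k = 1 / N := fun k => by rw [hz_succ]; simp only [hz]; ring
  have hz_alg : ∀ k : ℕ, IsAlgebraic ℚ (z k) := fun k => isAlgebraic_natCast_div k N
  have hpiece_sub : ∀ k : ℕ, k < N → Set.Icc (z k) (z (k + 1)) ⊆ Set.Icc (0:ℝ) 1 := fun k hk u hu =>
    ⟨(hz_nonneg k).trans hu.1, hu.2.trans (hz_le_one (k + 1) hk)⟩
  set a : ℕ → ℝ := fun k => A.eval (z k) with ha
  set b : ℕ → ℝ := fun k => B.eval (z k) with hb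
  have ha_alg : ∀ k, IsAlgebraic ℚ (a k) := fun k => by
    have := isAlgebraic_eval_ratCast A hA ((k : ℚ) / N)
    simpa [ha, hz] using this
  have hb_alg : ∀ k, IsAlgebraic ℚ (b k) := fun k => by
    have := isAlgebraic_eval_ratCast B hB ((k : ℚ) / N)
    simpa [hb, hz] using this
  have hab : ∀ k : ℕ, k ≤ N → a k ^ 2 + b k ^ 2 ≠ 0 := fun k hk => hAB _ (hz_mem k hk)
  set U : ℕ → Polynomial ℝ := fun k => Polynomial.C (a k) * A + Polynomial.C (b k) * B with hU
  set W : ℕ → Polynomial ℝ := fun k => Polynomial.C (a k) * B - Polynomial.C (b k) * A with hW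
  have hU_alg : ∀ k n, IsAlgebraic ℚ ((U k).coeff n) := fun k n =>
    recentre_coeff_isAlgebraic (ha_alg k) (hb_alg k) hA hB n
  have hW_alg : ∀ k n, IsAlgebraic ℚ ((W k).coeff n) := fun k n =>
    recentre_coeff_isAlgebraic' (ha_alg k) (hb_alg k) hA hB n
  have hUpos : ∀ k : ℕ, k < N → ∀ u ∈ Set.Icc (z k) (z (k + 1)), 0 < (U k).eval u := by
    intro k hk u hu
    have hu' : u ∈ Set.Icc ((k:ℝ) / N) (((k:ℝ) + 1) / N) := by rwa [← hz_succ]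
    have := hpos k hk u hu'
    rw [hU]
    simp only [recentre_eval, ha, hb, hz]
    linarith [mul_comm (A.eval u) (A.eval ((k:ℝ) / N)), mul_comm (B.eval u) (B.eval ((k:ℝ) / N))]
  have hWz : ∀ k : ℕ, (W k).eval (z k) = 0 := fun k => by
    simp only [hW, recentre_eval', ha, hb]; ring
  have hUW : ∀ k : ℕ, k ≤ N → ∀ u ∈ Set.Icc (0:ℝ) 1,
      ((U k).eval u * (Polynomial.derivative (W k)).eval u -
        (Polynomial.derivative (U k)).eval u * (W k).eval u) / ((U k).eval u ^ 2 + (W k).eval u ^ 2) = h u :=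
    fun k hk u hu => recentre_angular A B (a k) (b k) u (hab k hk) (hAB u hu)
  -- Step 4: the phase increments `φ k = arctan τ k = ∫_{z k}^{z (k+1)} h`
  set τ : ℕ → ℝ := fun k => (W k).eval (z (k + 1)) / (U k).eval (z (k + 1)) with hτ
  set φ : ℕ → ℝ := fun k => Real.arctan (τ k) with hφ
  have hφ_int : ∀ k : ℕ, k < N → φ k = ∫ u in (z k)..(z (k + 1)), h u := by
    intro k hk
    have hftc := stub_rungArctanFTC (U k) (W k) (z k) (z (k + 1)) (hz_le k) (hUpos k hk)
    rw [hWz k, zero_div, Real.arctan_zero, sub_zero] at hftc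
    simp only [hφ, hτ]
    rw [hftc]
    refine intervalIntegral.integral_congr fun u hu => ?_
    rw [Set.uIcc_of_le (hz_le k)] at hu
    exact hUW k hk.le u (hpiece_sub k hk hu)
  have hφ_sum : ∑ k ∈ Finset.range N, φ k = 0 := by
    rw [Finset.sum_congr rfl fun k hk => hφ_int k (Finset.mem_range.mp hk),
      intervalIntegral.sum_integral_adjacent_intervals fun k hk =>
        (hcont_h.mono (hpiece_sub k hk)).intervalIntegrable_of_Icc (hz_le k),
      hz0, hzN, hint]
  have hφ_bd : ∀ k : ℕ, k < N → |φ k| ≤ M / N := by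
    intro k hk
    rw [hφ_int k hk]
    have := intervalIntegral.norm_integral_le_of_norm_le_const (a := z k) (b := z (k + 1)) (C := M)
      (f := h) fun u hu => ?_
    · rw [Real.norm_eq_abs, hz_sub, abs_of_pos (one_div_pos.mpr hNpos), ← div_eq_mul_one_div] at this
      exact this
    · rw [Set.uIoc_of_le (hz_le k)] at hu
      rw [Real.norm_eq_abs]
      exact hMb u (hpiece_sub k hk ⟨hu.1.le, hu.2⟩)
  have hφ_lt : ∀ k : ℕ, k < N → |φ k| < Real.pi / 2 := fun k hk => (hφ_bd k hk).trans_lt hMN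
  have hMN' : M / N < Real.pi / 2 := hMN
  -- Step 5: the cone estimate keeps the leftover loop in the right half-plane
  have hcone : ∀ y ∈ Set.Icc (0:ℝ) 1, |∑ k ∈ Finset.range N, Real.arctan (τ k * y)| < Real.pi / 2 := by
    intro y hy
    have h1 : ∀ k ∈ Finset.range N,
        |Real.arctan (τ k * y) - y * φ k| ≤ |φ k| * Real.tan (φ k) ^ 2 := fun k hk => by
      have htk : Real.arctan (τ k * y) = Real.arctan (y * Real.tan (φ k)) := by
        simp only [hφ, Real.tan_arctan, mul_comm]
      rw [htk]
      exact stub_rungConeEstimate (φ k) y (hφ_lt k (Finset.mem_range.mp hk)) hy.1 hy.2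
    have h2 : ∀ k ∈ Finset.range N, |φ k| * Real.tan (φ k) ^ 2 ≤ (M / N) * Real.tan (M / N) ^ 2 := by
      intro k hk
      have hk' := Finset.mem_range.mp hk
      refine mul_le_mul (hφ_bd k hk') ?_ (sq_nonneg _) (by positivity)
      have habs : Real.tan (φ k) ^ 2 = Real.tan |φ k| ^ 2 := by
        rcases le_total 0 (φ k) with h0 | h0
        · rw [abs_of_nonneg h0]
        · rw [abs_of_nonpos h0, Real.tan_neg, neg_sq]
      rw [habs]
      refine rungConeEstimate_tan_sq_le (by linarith [Real.pi_pos, hM0, (by positivity : 0 ≤ M / N)]) hMN' ?_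
      rw [Set.uIcc_of_le (by positivity)]
      exact ⟨abs_nonneg _, hφ_bd k hk'⟩
    calc |∑ k ∈ Finset.range N, Real.arctan (τ k * y)|
        = |∑ k ∈ Finset.range N, (Real.arctan (τ k * y) - y * φ k) + y * ∑ k ∈ Finset.range N, φ k| := by
          rw [Finset.mul_sum, ← Finset.sum_add_distrib]
          simp only [sub_add_cancel]
      _ = |∑ k ∈ Finset.range N, (Real.arctan (τ k * y) - y * φ k)| := by rw [hφ_sum, mul_zero, add_zero]
      _ ≤ ∑ k ∈ Finset.range N, |Real.arctan (τ k * y) - y * φ k| := Finset.abs_sum_le_sum_abs _ _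
      _ ≤ ∑ k ∈ Finset.range N, |φ k| * Real.tan (φ k) ^ 2 := Finset.sum_le_sum h1
      _ ≤ ∑ k ∈ Finset.range N, (M / N) * Real.tan (M / N) ^ 2 := Finset.sum_le_sum h2
      _ = M * Real.tan (M / N) ^ 2 := by
          rw [Finset.sum_const, Finset.card_range, nsmul_eq_mul]
          field_simp
      _ < Real.pi / 2 := htan
  -- Step 6: the leftover loop `Q(y) = Π (1 + i τ_k y)` as real polynomials
  have hτ_alg : ∀ k, k < N → IsAlgebraic ℚ (τ k) := by
    intro k _
    have hWv : IsAlgebraic ℚ ((W k).eval (z (k + 1))) := by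
      have := isAlgebraic_eval_ratCast (W k) (hW_alg k) (((k:ℚ) + 1) / N)
      simpa [hz] using this
    have hUv : IsAlgebraic ℚ ((U k).eval (z (k + 1))) := by
      have := isAlgebraic_eval_ratCast (U k) (hU_alg k) (((k:ℚ) + 1) / N)
      simpa [hz] using this
    exact mem_algebraicClosure_iff.mp
      (div_mem (mem_algebraicClosure_iff.mpr hWv) (mem_algebraicClosure_iff.mpr hUv))
  obtain ⟨AQ, BQ, hAQc, hBQc, hAQ, hBQ, hnorm, hlog⟩ := stub_rungLeftoverLoop N τ hτ_alg
  have hR_pos : ∀ y : ℝ, 0 < ∏ k ∈ Finset.range N, Real.sqrt (1 + (τ k * y) ^ 2) := fun y =>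
    Finset.prod_pos fun k _ => Real.sqrt_pos.2 (by positivity)
  have hP_pos : ∀ y : ℝ, 0 < ∏ k ∈ Finset.range N, (1 + (τ k * y) ^ 2) := fun y =>
    Finset.prod_pos fun k _ => by positivity
  have hAQpos : ∀ y ∈ Set.Icc (0:ℝ) 1, 0 < AQ.eval y := by
    intro y hy
    rw [hAQ]
    have hc := abs_lt.mp (hcone y hy)
    exact mul_pos (hR_pos y) (Real.cos_pos_of_mem_Ioo ⟨by linarith [hc.1], hc.2⟩)
  have hBQ0 : BQ.eval 0 = 0 := by rw [hBQ]; simp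
  have hBQ1 : BQ.eval 1 = 0 := by
    rw [hBQ]
    simp only [mul_one]
    rw [show ∑ k ∈ Finset.range N, Real.arctan (τ k) = ∑ k ∈ Finset.range N, φ k from rfl, hφ_sum,
      Real.sin_zero, mul_zero]
  have hQid : ∀ y : ℝ, (AQ.eval y * (Polynomial.derivative BQ).eval y -
      (Polynomial.derivative AQ).eval y * BQ.eval y) / (AQ.eval y ^ 2 + BQ.eval y ^ 2) =
      ∑ k ∈ Finset.range N, τ k / (1 + (τ k * y) ^ 2) := fun y => by
    rw [hlog, hnorm, mul_div_cancel_left₀ _ (hP_pos y).ne']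
  -- Step 7: rung 3 in swapped coordinates absorbs the leftover
  obtain ⟨G2, D2, q2, hGD2, hq2, hid2⟩ := stub_rungAngularCertificateSwap γ (fun u => AQ.eval u)
    (fun u => BQ.eval u) (fun u => (Polynomial.derivative AQ).eval u) (fun u => (Polynomial.derivative BQ).eval u)
    hγ (isSemialgebraicFunOn_eval_apply hSsa hAQc 1) (isSemialgebraicFunOn_eval_apply hSsa hBQc 1)
    (isSemialgebraicFunOn_eval_apply hSsa (isAlgebraic_coeff_derivative hAQc) 1)
    (isSemialgebraicFunOn_eval_apply hSsa (isAlgebraic_coeff_derivative hBQc) 1)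
    hAQpos hBQ0 hBQ1 AQ.continuousOn BQ.continuousOn (Polynomial.derivative AQ).continuousOn
    (Polynomial.derivative BQ).continuousOn (fun u _ => AQ.hasDerivAt u) (fun u _ => BQ.hasDerivAt u)
  -- Step 8: one clamped certificate per piece
  have hpiece : ∀ k : Fin N, ∃ (G D : Fin 2 → (Fin 2 → ℝ) → ℝ) (K : Fin 2 → Set (Fin 2 → ℝ))
      (q : Fin 2 → IntegralRep 2),
      (∀ j, IsSemialgebraicFunOn ℚ S (G j) ∧ IsSemialgebraicFunOn ℚ S (D j) ∧ IsSemialgebraic ℚ (K j) ∧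
        (∃ B : ℝ, ∀ x ∈ S, |(G j) x| ≤ B) ∧
        (∀ x ∈ S, Set.Finite {s : ℝ | Function.update x j s ∈ (K j)}) ∧
        (∀ x ∈ S, ContinuousOn (fun s : ℝ => (G j) (Function.update x j s)) (Set.Icc (0:ℝ) 1)) ∧
        (∀ x ∈ S, x ∉ (K j) → x j ∈ Set.Ioo (0:ℝ) 1 →
          HasDerivAt (fun s : ℝ => (G j) (Function.update x j s)) ((D j) x) (x j))) ∧
      (∀ j, (q j).domain = S ∧ ∀ x ∈ S, (q j).integrand x =
        D j x - (G j (Function.update x j 1) - G j (Function.update x j 0))) ∧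
      ∀ x ∈ S, ∑ j, (q j).integrand x =
        γ * (if z k < x 0 ∧ x 0 < z (k + 1) then
            ((U k).eval (x 0) * (Polynomial.derivative (W k)).eval (x 0) -
              (Polynomial.derivative (U k)).eval (x 0) * (W k).eval (x 0)) /
              ((U k).eval (x 0) ^ 2 + (W k).eval (x 0) ^ 2)
          else 0) -
        γ * ((U k).eval (z (k + 1)) * (W k).eval (z (k + 1))) /
          ((U k).eval (z (k + 1)) ^ 2 + (W k).eval (z (k + 1)) ^ 2 * x 1 ^ 2) := fun k =>
    stub_rungClampedAngularCertificate γ (z k) (z (k + 1)) (U k) (W k) hγ (hz_alg k) (hz_alg (k + 1))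
      (hU_alg k) (hW_alg k) (hz_nonneg k) (hz_lt k) (hz_le_one (k + 1) k.2) (hUpos k k.2) (hWz k)
  choose G1 D1 K1 q1 hGD1 hq1 hid1 using hpiece
  -- Step 9: the null grid
  set Z : Set (Fin 2 → ℝ) := ⋃ k ∈ Finset.range (N + 1), {x : Fin 2 → ℝ | x 0 = z k} with hZ
  have hZsa : IsSemialgebraic ℚ Z :=
    Literature.ModelTheory.ExponentialFields.IsSemialgebraic.biUnion (k := ℚ) (Finset.range (N + 1))
      (fun k => {x : Fin 2 → ℝ | x 0 = z k}) fun k _ => isSemialgebraic_setOf_apply_eq_of_isAlgebraic (hz_alg k) 0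
  have hZvol : volume Z = 0 :=
    (measure_biUnion_null_iff (Finset.range (N + 1)).countable_toSet).mpr fun k _ => by
      rw [volume_pi]; exact Measure.pi_hyperplane _ _ _
  -- Step 10: assembling the `2N + 2` elements
  let ι := (Fin N × Fin 2) ⊕ Fin 2
  let e : Fin (N * 2 + 2) ≃ ι :=
    finSumFinEquiv.symm.trans (Equiv.sumCongr finProdFinEquiv.symm (Equiv.refl (Fin 2)))
  let dir : ι → Fin 2 := Sum.elim (fun p => p.2) (fun j => Fin.rev j)
  let Gι : ι → (Fin 2 → ℝ) → ℝ := Sum.elim (fun p => G1 p.1 p.2) (fun j => G2 j)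
  let Dι : ι → (Fin 2 → ℝ) → ℝ := Sum.elim (fun p => D1 p.1 p.2) (fun j => D2 j)
  let Kι : ι → Set (Fin 2 → ℝ) := Sum.elim (fun p => K1 p.1 p.2) (fun _ => ∅)
  let qι : ι → IntegralRep 2 := Sum.elim (fun p => q1 p.1 p.2) (fun j => q2 j)
  have hcond : ∀ s : ι, IsSemialgebraicFunOn ℚ S (Gι s) ∧ IsSemialgebraicFunOn ℚ S (Dι s) ∧
      IsSemialgebraic ℚ (Kι s) ∧ (∃ B : ℝ, ∀ x ∈ S, |(Gι s) x| ≤ B) ∧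
      (∀ x ∈ S, Set.Finite {s' : ℝ | Function.update x (dir s) s' ∈ (Kι s)}) ∧
      (∀ x ∈ S, ContinuousOn (fun s' : ℝ => (Gι s) (Function.update x (dir s) s')) (Set.Icc (0:ℝ) 1)) ∧
      (∀ x ∈ S, x ∉ (Kι s) → x (dir s) ∈ Set.Ioo (0:ℝ) 1 →
        HasDerivAt (fun s' : ℝ => (Gι s) (Function.update x (dir s) s')) ((Dι s) x) (x (dir s))) := by
    rintro (⟨k, j'⟩ | j')
    · exact hGD1 k j'
    · obtain ⟨h1, h2, h3, h4, h5⟩ := hGD2 j'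
      exact ⟨h1, h2, Literature.ModelTheory.ExponentialFields.isSemialgebraic_empty, h3,
        fun x _ => by simp [Kι], h4, fun x hx _ hxj => h5 x hx hxj⟩
  have hqc : ∀ s : ι, (qι s).domain = S ∧ ∀ x ∈ S, (qι s).integrand x =
      Dι s x - (Gι s (Function.update x (dir s) 1) - Gι s (Function.update x (dir s) 0)) := by
    rintro (⟨k, j'⟩ | j')
    · exact hq1 k j'
    · exact hq2 j'
  refine ⟨2, h12, N * 2 + 2, fun j => dir (e j), fun j => Gι (e j), fun j => Dι (e j), fun j => Kι (e j),
    fun j => qι (e j), Z, fun j => hcond (e j), fun j => hqc (e j), hZsa, hZvol, fun x hx hxZ => ?_⟩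
  -- the decomposition off the grid
  · have hx0 : x 0 ∈ Set.Icc (0:ℝ) 1 := hx 0 (Set.mem_univ _)
    have hgrid : ∀ k : ℕ, k ≤ N → x 0 ≠ z k := by
      intro k hk hxk
      exact hxZ (Set.mem_iUnion₂.mpr ⟨k, Finset.mem_range.mpr (Nat.lt_succ_of_le hk), hxk⟩)
    obtain ⟨k₀, hk₀N, hk₀in, hk₀uniq⟩ := exists_unique_piece hN1 hx0 hgrid
    rw [hti' _ (hx1 x hx)]
    have hsum : ∑ j : Fin (N * 2 + 2), (qι (e j)).integrand x = ∑ s : ι, (qι s).integrand x :=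
      Equiv.sum_comp e (fun s => (qι s).integrand x)
    rw [hsum, Fintype.sum_sum_type, Fintype.sum_prod_type]
    simp only [qι, Sum.elim_inl, Sum.elim_inr]
    rw [Finset.sum_congr rfl fun k _ => hid1 k x hx, ← hid2 x hx, hQid (x 1), Finset.sum_sub_distrib]
    -- the clamped pieces reproduce `γ h (x 0)` exactly once
    have hone : ∑ k : Fin N, γ * (if z k < x 0 ∧ x 0 < z (k + 1) then
        ((U k).eval (x 0) * (Polynomial.derivative (W k)).eval (x 0) -
          (Polynomial.derivative (U k)).eval (x 0) * (W k).eval (x 0)) /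
          ((U k).eval (x 0) ^ 2 + (W k).eval (x 0) ^ 2) else 0) = γ * h (x 0) := by
      rw [Finset.sum_eq_single ⟨k₀, hk₀N⟩]
      · simp only
        rw [if_pos (by simpa [hz, hz_succ] using hk₀in), hUW k₀ hk₀N.le _ hx0]
      · intro k _ hk
        rw [if_neg, mul_zero]
        intro hcond
        apply hk
        ext
        exact hk₀uniq k (by simpa [hz, hz_succ] using hcond)
      · intro hk; exact absurd (Finset.mem_univ _) hk
    -- the leftovers are the half-angle kernels of the loop `Q`
    have hleft : ∑ k : Fin N, γ * ((U k).eval (z (k + 1)) * (W k).eval (z (k + 1))) /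
        ((U k).eval (z (k + 1)) ^ 2 + (W k).eval (z (k + 1)) ^ 2 * x 1 ^ 2) =
        γ * ∑ k ∈ Finset.range N, τ k / (1 + (τ k * x 1) ^ 2) := by
      rw [Finset.mul_sum, ← Fin.sum_univ_eq_sum_range]
      refine Finset.sum_congr rfl fun k _ => ?_
      have hUk : (U k).eval (z (k + 1)) ≠ 0 := (hUpos k k.2 _ ⟨hz_le k, le_rfl⟩).ne'
      rw [mul_div_assoc, leftover_eq_halfAngle hUk]
    show γ * h ((fun l : Fin 1 => x (Fin.castLE h12 l)) 0) = _
    rw [hone, hleft]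
    show γ * h (x 0) = _
    ring


/-- **The crux on the full angular sector (kernel form).** A closed-interval representation whose integrand is the
angular derivative `γ·Im(P′/P)` of a zero-free complex polynomial loop with real algebraic coefficients and whose value
vanishes is a Kontsevich–Zagier relation (`fibrewiseStokesGeneration_angularSector` ∘ the landed bridge
`of_mem_relations_of_fibStokesDecomposition`). [cite: KontsevichZagier2001, §1.2 Conjecture 1] -/
theorem of_mem_relations_angularSector (γ : ℝ) (A B : Polynomial ℝ) (hγ : IsAlgebraic ℚ γ)
    (hA : ∀ n, IsAlgebraic ℚ (A.coeff n)) (hB : ∀ n, IsAlgebraic ℚ (B.coeff n))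
    (hAB : ∀ u ∈ Set.Icc (0:ℝ) 1, A.eval u ^ 2 + B.eval u ^ 2 ≠ 0) (t : IntegralRep 1)
    (ht : t.domain = Set.pi Set.univ (fun _ : Fin 1 => Set.Icc (0:ℝ) 1))
    (hti : ∀ z ∈ Set.pi Set.univ (fun _ : Fin 1 => Set.Icc (0:ℝ) 1), t.integrand z =
      γ * ((A.eval (z 0) * (Polynomial.derivative B).eval (z 0) -
        (Polynomial.derivative A).eval (z 0) * B.eval (z 0)) / (A.eval (z 0) ^ 2 + B.eval (z 0) ^ 2)))
    (hv : t.value = 0) : of t ∈ relations :=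
  of_mem_relations_of_fibStokesDecomposition 1 t ht
    (fibrewiseStokesGeneration_angularSector γ A B hγ hA hB hAB t ht hti hv)

end Summit.KontsevichZagierPeriods.KontsevichZagierPeriods.Cruxes.StokesGeneration.FibrewiseStokes

end
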